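import Summits.CriticalPhenomena.PercolationContinuityZ3.Theorems.PercNearOneGluingNoHeavyQuantFiveBlobs
import HarnessLib

/-!
# QUANT lane R8, T-DEC: the law of FOUR blobs `(k,g)` and ONE blob `(k, c·g)` — the width-5 lift family `(cg, g, g, g, g)` of the glued
# quintuple — at its six atoms; a monomial box bound (prim-quant-census-2 gen 82, file 7)

builds on p205010 (kernel theorem, internal audit signed; external expert review pending)

Support file (`--supports stmt-CriticalPhenomena-4575`), QUANT lane census seat prim-quant-census-2 (gen 82); memo
`run/shared/lean/prim/quant/prim-quant-census-2-g82/REFLECTION-G82.md` §3 (width 5).  Theorems only, standard axioms, no sorries, no definitions.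

The lift `ρ⁴ ∗ gate_c ρ` of the identical glued quintuple (`…/prim-quant-census-2-g80/TRIPLE-G80.md` §5) needs conjecture BLOB-AFL for the gate
vector `(cg, g, g, g, g)`: the blob law `blobLaw [(k,cg),(k,g),(k,g),(k,g),(k,g)]` heavy at floor `(4+c)g/5`, target `k(4+c)g`.  This file records its
atoms `P_j = (1−cg)·B_j + cg·B_{j−1}`, `B_j = C(4,j)g^j(1−g)^{4−j}` (`pb_fourOne_0 … pb_fourOne_5`, via `pb_cons_zero/succ` and `blobLaw_replicate`),
and the box bound `mono_le_box` (`t^a r^b ≤ δ^a ε^b`) used by the cell certificates of the uniform-spreading load (memo §3: cells in `s = (4+c)g`,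
cleared load `= g^a(1−g)^m·G_cell(g,c)`, `G_cell > 0` by box expansion in the rectangle coordinates `(s,c)`).

HONEST STATUS.  Bookkeeping only; BLOB-AFL(5) for this family is OPEN (cells not yet certified in the kernel); `SiblingStep`, `FarTreeRow`,
`GluedLemmaW`, `GluedDominatedMass` OPEN; RATE class (log\*) / honest sentence of `run/shared/lean/prim/quant/README.md` unchanged.  [this work].
Nothing here is cited as a published result.  The gluing rows served [cite: KozmaNitzan2024, Conjecture 3 (p. 15)]; product measure
[cite: Grimmett1999, §1.3 p. 10].
-/

noncomputable section

open scoped BigOperators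

namespace Summit.CriticalPhenomena.PercolationContinuityZ3.Theorems
namespace Quant

open Finset

/-- the two-point law `{lo, hi; g}` (as in `…QuantLawDEC`) -/
local notation3 "TP[" lo ", " hi ", " g ", " h "]" =>
  (g : ℝ) * (if (h : ℕ) = (hi : ℕ) then (1 : ℝ) else 0) + (1 - (g : ℝ)) * (if (h : ℕ) = (lo : ℕ) then (1 : ℝ) else 0)

/-- the cheapest admissible gate of the pair `{l, h}` at floor `x`, target `T`: `max(x, (T − 2l)/(h − l))` -/
local notation3 "CG[" x ", " T ", " l ", " h "]" => max (x : ℝ) (((T : ℝ) - 2 * ((l : ℕ) : ℝ)) / (((h : ℕ) : ℝ) - ((l : ℕ) : ℝ)))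

/-- the Poisson-binomial point mass `P_G(j)`: the law of the blobs `(k, g)`, `g ∈ G`, at the atom `j·k` -/
local notation3 "PB[" k ", " G ", " j "]" => LawDec.blobLaw (List.map (fun g : ℝ => ((k : ℕ), g)) G) ((j : ℕ) * (k : ℕ))

namespace LawDec

/-- monomial bound in a box: `t^a r^b ≤ δ^a ε^b` for `0 ≤ t ≤ δ`, `0 ≤ r ≤ ε`. [folklore] -/
theorem mono_le_box {t δ r ε : ℝ} (ht0 : 0 ≤ t) (ht1 : t ≤ δ) (hr0 : 0 ≤ r) (hr1 : r ≤ ε) (a b : ℕ) :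
    t ^ a * r ^ b ≤ δ ^ a * ε ^ b :=
  mul_le_mul (pow_le_pow_left₀ ht0 ht1 a) (pow_le_pow_left₀ hr0 hr1 b) (pow_nonneg hr0 b) (pow_nonneg (ht0.trans ht1) a)

/-! ### The law of four blobs `(k,g)` and one blob `(k, c·g)` -/

/-- atom `0`. [this work] -/
theorem pb_fourOne_0 (k : ℕ) (hk : 0 < k) (g c : ℝ) :
    blobLaw [((k : ℕ), c * g), (k, g), (k, g), (k, g), (k, g)] (0 * k) = (1 - c * g) * ((1 - g) ^ 4) := by
  have h := pb_cons_zero k hk (c * g) [g, g, g, g]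
  have b0 := blobLaw_replicate k hk g 4 0
  simp only [List.map_cons, List.map_nil] at h
  rw [h, show [((k:ℕ), g), (k, g), (k, g), (k, g)] = List.replicate 4 (k, g) from rfl, b0]
  norm_num

/-- atom `j·k`, `j = 1..5`: `P_j = (1−cg)·B_j + cg·B_{j−1}`, `B = Bin(4,g)`. [this work] -/
theorem pb_fourOne_succ (k : ℕ) (hk : 0 < k) (g c : ℝ) (j : ℕ) :
    blobLaw [((k : ℕ), c * g), (k, g), (k, g), (k, g), (k, g)] ((j + 1) * k)
      = (1 - c * g) * ((Nat.choose 4 (j + 1) : ℝ) * g ^ (j + 1) * (1 - g) ^ (4 - (j + 1)))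
        + c * g * ((Nat.choose 4 j : ℝ) * g ^ j * (1 - g) ^ (4 - j)) := by
  have h := pb_cons_succ k (c * g) [g, g, g, g] j
  simp only [List.map_cons, List.map_nil] at h
  rw [h, show [((k:ℕ), g), (k, g), (k, g), (k, g)] = List.replicate 4 (k, g) from rfl, blobLaw_replicate k hk g 4 (j + 1),
    blobLaw_replicate k hk g 4 j]

/-- atom `k`. [this work] -/
theorem pb_fourOne_1 (k : ℕ) (hk : 0 < k) (g c : ℝ) :
    blobLaw [((k : ℕ), c * g), (k, g), (k, g), (k, g), (k, g)] (1 * k) = (1 - c * g) * (4 * g * (1 - g) ^ 3) + c * g * ((1 - g) ^ 4) := by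
  have h := pb_fourOne_succ k hk g c 0; rw [zero_add] at h; rw [h]; norm_num [Nat.choose]
/-- atom `2k`. [this work] -/
theorem pb_fourOne_2 (k : ℕ) (hk : 0 < k) (g c : ℝ) :
    blobLaw [((k : ℕ), c * g), (k, g), (k, g), (k, g), (k, g)] (2 * k) = (1 - c * g) * (6 * g ^ 2 * (1 - g) ^ 2) + c * g * (4 * g * (1 - g) ^ 3) := by
  have h := pb_fourOne_succ k hk g c 1; rw [h]; norm_num [Nat.choose]
/-- atom `3k`. [this work] -/
theorem pb_fourOne_3 (k : ℕ) (hk : 0 < k) (g c : ℝ) :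
    blobLaw [((k : ℕ), c * g), (k, g), (k, g), (k, g), (k, g)] (3 * k) = (1 - c * g) * (4 * g ^ 3 * (1 - g)) + c * g * (6 * g ^ 2 * (1 - g) ^ 2) := by
  have h := pb_fourOne_succ k hk g c 2; rw [h]; norm_num [Nat.choose]
/-- atom `4k`. [this work] -/
theorem pb_fourOne_4 (k : ℕ) (hk : 0 < k) (g c : ℝ) :
    blobLaw [((k : ℕ), c * g), (k, g), (k, g), (k, g), (k, g)] (4 * k) = (1 - c * g) * (g ^ 4) + c * g * (4 * g ^ 3 * (1 - g)) := by
  have h := pb_fourOne_succ k hk g c 3; rw [h]; norm_num [Nat.choose]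
/-- atom `5k`. [this work] -/
theorem pb_fourOne_5 (k : ℕ) (hk : 0 < k) (g c : ℝ) :
    blobLaw [((k : ℕ), c * g), (k, g), (k, g), (k, g), (k, g)] (5 * k) = c * g * (g ^ 4) := by
  have h := pb_cons_succ k (c * g) [g, g, g, g] 4
  simp only [List.map_cons, List.map_nil] at h
  have htop : blobLaw [((k:ℕ), g), (k, g), (k, g), (k, g)] ((4 + 1) * k) = 0 :=
    blobLaw_eq_zero _ _ (by simp only [blobTop]; omega)
  rw [h, htop, show [((k:ℕ), g), (k, g), (k, g), (k, g)] = List.replicate 4 (k, g) from rfl, blobLaw_replicate k hk g 4 4]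
  norm_num

end LawDec
end Quant
end Summit.CriticalPhenomena.PercolationContinuityZ3.Theorems
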